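import Summits.CriticalPhenomena.PercolationContinuityZ3.Theorems.Transplant.WeightedConeCritical
import Summits.CriticalPhenomena.PercolationContinuityZ3.Theorems.Transplant.DiagonalConeUniqueness
import HarnessLib

/-!
# WEIGHTED CONES of `ℤ³` — III: the argmin-ratio CLIMB and its slack, coordinate bounds, the cut sets `{⟨v,x⟩ ≤ N}`, their exits, the
# escape-and-climb datum (first file of the uniqueness column for `𝕂_{v,τ,h} = {h ≤ ⟨v,x⟩, vⱼxᵢ − vᵢxⱼ ≤ τ⟨v,x⟩}`)

builds on p205010 (kernel theorem, internal audit signed; external expert review pending) — NOT used in this file.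
Lane `prim-bschramm`, seat `prim-bschramm-p2` (gen 30; class C1b = sub-domains of `ℤ³` at their own critical point, METHOD = input substitution;
memo `HOME/bschramm/P2-LATTICES.md` §106); helper file (`--supports stmt-CriticalPhenomena-4575 --as helper`) for ROW N6 of TABLE v44:
UNIQUENESS of the infinite cluster in the cone around an ARBITRARY direction `v` of the open octant, by the Aizenman–Chayes–Chayes–Fröhlich–Russo
exterior-connection mechanism in station form (`TubeSlabUniq.ae_numInfiniteClusters_le_one_of_station`), following gen 29's design for the
diagonal cone (`DiagonalConeExits/Move/Schedule/Uniqueness`) WITH WEIGHTS: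
(i) cut by the real HEIGHT `H = ⟨v,x⟩`: `Λ_N = {H ≤ N} ∩ [-B_N, B_N]³`; an exit `u` (`H(u) ≤ N`) has a cone neighbour `u + eⱼ` with `H > N` (§2);
(ii) ESCAPE along that edge and CLIMB `c` argmin-ratio steps (`WeightedConeGeometry.step_mem`): every step raises `H` by `≥ κ` and the only pair
terms that grow were `≤ 0`, so after `m` steps EVERY pair inequality `D_{ij} ≤ τH` holds with SLACK `mτκ` (`climb_slack`, §1 — no side condition,
because a growing term is `≤ K ≤ τh`); (iii) then raise the minimal-ratio coordinate by link moves (`WeightedConeMove`).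
* §1 `lowIdx`, `climb`, `hgt_climb`, `climb_apply_mem`, `climb_mem`, **`climb_slack`**;
* §2 **`coord_bounds`** (`|⟨v,v⟩xⱼ − vⱼH| ≤ τH(v₀+v₁+v₂)`), `abs_le_of_mem`, the cut sets `cut v B N` (finite, increasing, exhausting) and
  **`exit_of_cut`**;
* §3 **`escape_climb_datum`**: `n + 1` extra open edges join an exit `u` to `climb n (u + eⱼ)` through exterior steps of `Λ ⊆ {H ≤ N}` (probability one).
[cite: AizenmanChayesChayesFrohlichRusso1983, §4 (4.26), Lemma 4.2 (a)] [cite: GrimmettPercolation1999, §7.2 p. 148; §11.5 notes p. 347]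
[cite: ChayesChayes1986Wedges, §1] -/

noncomputable section

namespace Summit.CriticalPhenomena.PercolationContinuityZ3.Theorems.Transplant

namespace WCone

open MeasureTheory Literature.Probability.Percolation Literature.Probability.LatticeModels SimpleGraph HSU OrthantUniq HalfSlabUniq
  TubeSlabUniq DesignTransport WallUniq DiagCone Filter
open scoped Classical

/-! ## §1 The argmin-ratio coordinate, the climb, the slack -/

/-- An argmin-ratio coordinate of `x` (some `i` with `D_{ij}(x) ≤ 0` for all `j`, if one exists; else `0`). [folklore] -/
def lowIdx (v : Fin 3 → ℝ) (x : Site 3) : Fin 3 := if hex : ∃ i : Fin 3, ∀ j, dev v x i j ≤ 0 then Classical.choose hex else 0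

/-- **The climb**: `n` argmin-ratio steps, `climb (n+1) x = climb n x + e_{lowIdx (climb n x)}`. [folklore] -/
def climb (v : Fin 3 → ℝ) : ℕ → Site 3 → Site 3
  | 0, x => x
  | n + 1, x => climb v n x + Pi.single (lowIdx v (climb v n x)) 1

/-- `climb 0 x = x`. [folklore] -/
@[simp] theorem climb_zero (v : Fin 3 → ℝ) (x : Site 3) : climb v 0 x = x := rfl

/-- The successor step of the climb. [folklore] -/
theorem climb_succ (v : Fin 3 → ℝ) (n : ℕ) (x : Site 3) : climb v (n + 1) x = climb v n x + Pi.single (lowIdx v (climb v n x)) 1 := rfl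

/-- **Coordinates of the climb** lie in `[xⱼ, xⱼ + n]`. [folklore] -/
theorem climb_apply_mem (v : Fin 3 → ℝ) (n : ℕ) (x : Site 3) (j : Fin 3) : x j ≤ climb v n x j ∧ climb v n x j ≤ x j + n := by
  induction n with
  | zero => simp
  | succ n ih =>
    rw [climb_succ, DiagCone.step_apply]
    obtain ⟨h1, h2⟩ := ih
    by_cases hj : j = lowIdx v (climb v n x)
    · rw [if_pos hj]; push_cast; constructor <;> omega
    · rw [if_neg hj]; push_cast; constructor <;> omega

/-- Consecutive climb points are lattice neighbours. [folklore] -/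
theorem climb_adj (v : Fin 3 → ℝ) (n : ℕ) (x : Site 3) : (zdGraph 3).Adj (climb v n x) (climb v (n + 1) x) := by
  rw [climb_succ, zdGraph_adj_iff]; exact ⟨_, Or.inl rfl⟩

section Cone

variable {v : Fin 3 → ℝ} {κ K τ h : ℝ} (hκ : 0 < κ) (hvκ : ∀ i, κ ≤ v i) (hvK : ∀ i, v i ≤ K) (hτ : 0 < τ) (hh : K ≤ τ * h)
  {D : Set (Site 3)} (hCD : ∀ x : Site 3, x ∈ D ↔ h ≤ hgt v x ∧ ∀ i j : Fin 3, dev v x i j ≤ τ * hgt v x)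

include hκ hvκ in
/-- `lowIdx x` is an argmin-ratio coordinate: `D_{lowIdx x, j}(x) ≤ 0` for all `j`. [folklore] -/
theorem lowIdx_low (x : Site 3) : ∀ j, dev v x (lowIdx v x) j ≤ 0 := by
  have hex := exists_low hκ hvκ x
  unfold lowIdx
  rw [dif_pos hex]
  exact Classical.choose_spec hex

include hvκ hvK in
/-- **Height of the climb**: `H(x) + nκ ≤ H(climb n x) ≤ H(x) + nK`. [folklore] -/
theorem hgt_climb (x : Site 3) : ∀ n : ℕ, hgt v x + n * κ ≤ hgt v (climb v n x) ∧ hgt v (climb v n x) ≤ hgt v x + n * K := by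
  intro n
  induction n with
  | zero => simp
  | succ n ih =>
    rw [climb_succ, hgt_step]
    have h1 := hvκ (lowIdx v (climb v n x)); have h2 := hvK (lowIdx v (climb v n x))
    push_cast
    constructor <;> linarith [ih.1, ih.2]

include hκ hvκ hvK hτ hh hCD in
/-- **The climb stays in the cone** (argmin-ratio steps, `WeightedConeGeometry.step_mem`). [folklore] -/
theorem climb_mem {x : Site 3} (hx : x ∈ D) : ∀ n, climb v n x ∈ D := by
  intro n
  induction n with
  | zero => exact hx
  | succ n ih => rw [climb_succ]; exact step_mem hκ hvκ hvK hτ hh hCD ih _ (lowIdx_low hκ hvκ _)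

include hκ hvκ hvK hτ hh hCD in
/-- **THE SLACK CREATED BY THE CLIMB.**  If `x ∈ 𝕂` then after `m` argmin-ratio steps every pair inequality holds with slack `mτκ`:
`D_{ij}(y) + mτκ ≤ τH(y)`, `y = climb m x`.  (A step raises `τH` by `≥ τκ`; the terms `D_{ij}` that grow were `≤ 0` and become `≤ K ≤ τh ≤ τH(x)`,
while `τH(y) ≥ τH(x) + mτκ`; the others do not grow.)  No side condition. [folklore] -/
theorem climb_slack {x : Site 3} (hx : x ∈ D) :
    ∀ m : ℕ, ∀ i j : Fin 3, dev v (climb v m x) i j + m * (τ * κ) ≤ τ * hgt v (climb v m x) := by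
  obtain ⟨hs, hd⟩ := (hCD x).1 hx
  have h0 := (pos_K_h hκ hvκ hvK hτ hh).2
  have hKH : K ≤ τ * hgt v x := hh.trans (mul_le_mul_of_nonneg_left hs hτ.le)
  intro m
  induction m with
  | zero => intro i j; simpa using hd i j
  | succ m ih =>
    intro i j
    set y := climb v m x with hy
    set l := lowIdx v y with hl
    have hgrow := (hgt_climb hvκ hvK x (m + 1)).1
    rw [climb_succ, ← hy, ← hl] at hgrow ⊢
    rw [hgt_step] at hgrow ⊢
    rw [dev_step]
    have hvl := hvκ l
    have hτκ : 0 ≤ τ * κ := mul_nonneg hτ.le hκ.le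
    have hτy : τ * (hgt v x + ((m + 1 : ℕ) : ℝ) * κ) ≤ τ * (hgt v y + v l) := mul_le_mul_of_nonneg_left hgrow hτ.le
    push_cast at hτy ⊢
    have hτx : 0 ≤ τ * hgt v x := mul_nonneg hτ.le (h0.le.trans hs)
    have hτv : τ * κ ≤ τ * v l := mul_le_mul_of_nonneg_left hvl hτ.le
    have hring : (((m : ℕ) : ℝ) + 1) * (τ * κ) = τ * ((((m : ℕ) : ℝ) + 1) * κ) := by ring
    by_cases hi : i = l
    · by_cases hj : j = l
      · rw [if_pos hi, if_pos hj, hi, hj, dev_self]; linarith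
      · rw [if_pos hi, if_neg hj, hi]
        have hlow := lowIdx_low hκ hvκ y j
        rw [← hl] at hlow
        have hKj := hvK j
        linarith
    · rw [if_neg hi]
      have hij := ih i j
      by_cases hj : j = l
      · rw [if_pos hj]; have := (v_pos hκ hvκ i).le; linarith
      · rw [if_neg hj]; linarith

/-! ## §2 Coordinates of cone points; the cut sets by height and their exits -/

include hκ hvκ hCD in
/-- **Coordinates of a cone point follow the ray**: `|⟨v,v⟩xⱼ − vⱼH(x)| ≤ τH(x)(v₀+v₁+v₂)` (sum the pair inequalities `D_{ji} ≤ τH`, resp.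
`D_{ij} ≤ τH`, with the weights `vᵢ ≥ 0`). [folklore] -/
theorem coord_bounds {x : Site 3} (hx : x ∈ D) (j : Fin 3) :
    (v 0 * v 0 + v 1 * v 1 + v 2 * v 2) * (x j : ℝ) - v j * hgt v x ≤ τ * hgt v x * (v 0 + v 1 + v 2) ∧
      v j * hgt v x - (v 0 * v 0 + v 1 * v 1 + v 2 * v 2) * (x j : ℝ) ≤ τ * hgt v x * (v 0 + v 1 + v 2) := by
  obtain ⟨-, hd⟩ := (hCD x).1 hx
  have hv0 := (v_pos hκ hvκ 0).le; have hv1 := (v_pos hκ hvκ 1).le; have hv2 := (v_pos hκ hvκ 2).le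
  have a0 := mul_le_mul_of_nonneg_left (hd j 0) hv0
  have a1 := mul_le_mul_of_nonneg_left (hd j 1) hv1
  have a2 := mul_le_mul_of_nonneg_left (hd j 2) hv2
  have b0 := mul_le_mul_of_nonneg_left (hd 0 j) hv0
  have b1 := mul_le_mul_of_nonneg_left (hd 1 j) hv1
  have b2 := mul_le_mul_of_nonneg_left (hd 2 j) hv2
  simp only [dev, hgt] at a0 a1 a2 b0 b1 b2 ⊢
  constructor <;> linarith

/-- The coordinate-bound constant `C = (K + τ(v₀+v₁+v₂))/⟨v,v⟩`: `|xⱼ| ≤ C·H(x)` on the cone. [folklore] -/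
def bnd (v : Fin 3 → ℝ) (τ K : ℝ) : ℝ := (K + τ * (v 0 + v 1 + v 2)) / (v 0 * v 0 + v 1 * v 1 + v 2 * v 2)

include hκ hvκ hvK hτ hh hCD in
/-- **Coordinates of a cone point are bounded by its height**: `|xⱼ| ≤ C·S` when `H(x) ≤ S`, `C = bnd v τ K`. [folklore] -/
theorem abs_le_of_mem {x : Site 3} (hx : x ∈ D) {S : ℝ} (hS : hgt v x ≤ S) : ∀ j, |(x j : ℝ)| ≤ bnd v τ K * S := by
  have hV := normSq_pos hκ hvκ
  have h0 := (pos_K_h hκ hvκ hvK hτ hh).2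
  have hH : 0 < hgt v x := h0.trans_le ((hCD x).1 hx).1
  have hsum : 0 ≤ v 0 + v 1 + v 2 := by
    have := v_pos hκ hvκ 0; have := v_pos hκ hvκ 1; have := v_pos hκ hvκ 2; positivity
  intro j
  obtain ⟨h1, h2⟩ := coord_bounds hκ hvκ hCD hx j
  have hvj := hvK j; have hvj0 := (v_pos hκ hvκ j).le
  set V := v 0 * v 0 + v 1 * v 1 + v 2 * v 2 with hVdef
  -- `V|xⱼ| ≤ vⱼH + τH·Σv ≤ (K + τΣv)·H ≤ (K + τΣv)·S`
  have hup : V * (x j : ℝ) ≤ (K + τ * (v 0 + v 1 + v 2)) * S := by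
    have : v j * hgt v x ≤ K * S := mul_le_mul hvj hS hH.le ((v_pos hκ hvκ j).le.trans hvj)
    have : τ * hgt v x * (v 0 + v 1 + v 2) ≤ τ * S * (v 0 + v 1 + v 2) :=
      mul_le_mul_of_nonneg_right (mul_le_mul_of_nonneg_left hS hτ.le) hsum
    nlinarith
  have hlo : -((K + τ * (v 0 + v 1 + v 2)) * S) ≤ V * (x j : ℝ) := by
    have : v j * hgt v x ≤ K * S := mul_le_mul hvj hS hH.le ((v_pos hκ hvκ j).le.trans hvj)
    have : τ * hgt v x * (v 0 + v 1 + v 2) ≤ τ * S * (v 0 + v 1 + v 2) :=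
      mul_le_mul_of_nonneg_right (mul_le_mul_of_nonneg_left hS hτ.le) hsum
    nlinarith
  have hC : bnd v τ K * S = (K + τ * (v 0 + v 1 + v 2)) * S / V := by unfold bnd; rw [hVdef]; ring
  rw [hC, abs_le]
  constructor
  · rw [neg_le, le_div_iff₀ hV]; linarith
  · rw [le_div_iff₀ hV]; linarith

/-- **The box sizes of the cut sets**: `B_N = N + ⌈C·(N + K)⌉` (monotone, `N ≤ B_N`, and every cone point of height `≤ N + K` lies in `[-B_N, B_N]³`).
[cite: AizenmanChayesChayesFrohlichRusso1983, §4 (4.26)] -/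
def boxR (v : Fin 3 → ℝ) (τ K : ℝ) (N : ℕ) : ℕ := N + ⌈bnd v τ K * ((N : ℝ) + K)⌉₊

include hκ hvκ hvK hτ hh in
/-- `B_N` is monotone and `N ≤ B_N`. [folklore] -/
theorem boxR_mono : Monotone (boxR v τ K) ∧ ∀ N, N ≤ boxR v τ K N := by
  have hK := (pos_K_h hκ hvκ hvK hτ hh).1
  have hC : 0 ≤ bnd v τ K := by
    unfold bnd
    have := v_pos hκ hvκ 0; have := v_pos hκ hvκ 1; have := v_pos hκ hvκ 2
    positivity
  refine ⟨fun N N' hNN => ?_, fun N => Nat.le_add_right _ _⟩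
  unfold boxR
  have : bnd v τ K * ((N : ℝ) + K) ≤ bnd v τ K * ((N' : ℝ) + K) :=
    mul_le_mul_of_nonneg_left (by have h1 : (N : ℝ) ≤ N' := Nat.cast_le.2 hNN; linarith) hC
  exact Nat.add_le_add hNN (Nat.ceil_mono this)

include hκ hvκ hvK hτ hh hCD in
/-- **Cone points of height `≤ N + K` lie in the box `[-B_N, B_N]³`.** [folklore] -/
theorem mem_boxSet_of_hgt {N : ℕ} {x : Site 3} (hx : x ∈ D) (hs : hgt v x ≤ (N : ℝ) + K) : x ∈ boxSet 3 (boxR v τ K N) := by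
  rw [mem_boxSet_iff]
  intro j
  have h1 := abs_le_of_mem hκ hvκ hvK hτ hh hCD hx hs j
  have h2 : bnd v τ K * ((N : ℝ) + K) ≤ (⌈bnd v τ K * ((N : ℝ) + K)⌉₊ : ℝ) := Nat.le_ceil _
  have h3 : |(x j : ℝ)| ≤ ((boxR v τ K N : ℕ) : ℝ) := by unfold boxR; push_cast; linarith [abs_nonneg ((x j : ℝ))]
  have h4 : ((|x j| : ℤ) : ℝ) ≤ (((boxR v τ K N : ℕ) : ℤ) : ℝ) := by push_cast; exact h3
  exact abs_le.1 (by exact_mod_cast h4)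

/-- **The cut sets by height**: `Λ_N = {x ∈ ℤ³ | ⟨v,x⟩ ≤ N} ∩ [-B_N, B_N]³`. [cite: AizenmanChayesChayesFrohlichRusso1983, §4 (4.26)] -/
def cut (v : Fin 3 → ℝ) (B : ℕ → ℕ) (N : ℕ) : Set (Site 3) := {x | hgt v x ≤ N ∧ x ∈ boxSet 3 (B N)}

/-- Membership in a cut set. [folklore] -/
theorem mem_cut {B : ℕ → ℕ} {N : ℕ} {x : Site 3} : x ∈ cut v B N ↔ hgt v x ≤ N ∧ x ∈ boxSet 3 (B N) := Iff.rfl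

/-- Cut sets are finite, increase when `B` does, and exhaust `ℤ³` when `N ≤ B_N`. [folklore] -/
theorem cut_props {B : ℕ → ℕ} (hB : Monotone B) (hNB : ∀ N, N ≤ B N) :
    (∀ N, (cut v B N).Finite) ∧ Monotone (cut v B) ∧ ∀ x : Site 3, ∃ N, x ∈ cut v B N := by
  refine ⟨fun N => (boxSet_finite (B N)).subset fun _ hx => hx.2, fun N N' hNN x hx => ?_, fun x => ?_⟩
  · exact ⟨hx.1.trans (by exact_mod_cast hNN), boxSet_mono (hB hNN) hx.2⟩
  · obtain ⟨N₁, hN₁⟩ := boxSet_exhaust x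
    refine ⟨max N₁ ⌈hgt v x⌉₊, ?_, boxSet_mono ((hNB N₁).trans (hB (le_max_left _ _))) hN₁⟩
    have h1 : hgt v x ≤ (⌈hgt v x⌉₊ : ℝ) := Nat.le_ceil _
    have h2 : ((⌈hgt v x⌉₊ : ℕ) : ℝ) ≤ ((max N₁ ⌈hgt v x⌉₊ : ℕ) : ℝ) := by exact_mod_cast le_max_right _ _
    exact h1.trans h2

include hκ hvκ hvK hτ hh hCD in
/-- **Exits of a cut set.**  A point `u` of `Λ_N` with a `𝕂`-neighbour outside `Λ_N` is a cone point of height `≤ N` with a cone neighbour `u + eⱼ` of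
height `> N` (the neighbour has height `≤ H(u) + K ≤ N + K`, hence lies in the box, hence has height `> N`, hence is `u + eⱼ`).
[cite: AizenmanChayesChayesFrohlichRusso1983, §4 (4.26)] -/
theorem exit_of_cut {N : ℕ} {u : Site 3} (hu : u ∈ cut v (boxR v τ K) N)
    (hw : ∃ w, w ∉ cut v (boxR v τ K) N ∧ (withinGraph (zdGraph 3) D).Adj u w) :
    u ∈ D ∧ hgt v u ≤ N ∧ ∃ j : Fin 3, u + Pi.single j 1 ∈ D ∧ (N : ℝ) < hgt v (u + Pi.single j 1) := by
  obtain ⟨w, hwΛ, hadj⟩ := hw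
  rw [withinGraph_adj] at hadj
  obtain ⟨hzd, huD, hwD⟩ := hadj
  have hu1 : hgt v u ≤ N := hu.1
  obtain ⟨j, hj | hj⟩ := (zdGraph_adj_iff u w).1 hzd
  · -- `w = u + eⱼ`
    have hws : hgt v w = hgt v u + v j := by rw [hj, hgt_step]
    have hwbox : w ∈ boxSet 3 (boxR v τ K N) :=
      mem_boxSet_of_hgt hκ hvκ hvK hτ hh hCD hwD (by rw [hws]; have := hvK j; linarith)
    have hwgt : ¬ (hgt v w ≤ N) := fun hle => hwΛ ⟨hle, hwbox⟩
    refine ⟨huD, hu1, j, hj ▸ hwD, ?_⟩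
    rw [← hj]; exact not_le.1 hwgt
  · -- `u = w + eⱼ`: then `H(w) < H(u) ≤ N` and `w` is in the box — so `w ∈ Λ_N`, contradiction
    exfalso
    have hws : hgt v u = hgt v w + v j := by rw [hj, hgt_step]
    have hvj := v_pos hκ hvκ j
    have hwbox : w ∈ boxSet 3 (boxR v τ K N) :=
      mem_boxSet_of_hgt hκ hvκ hvK hτ hh hCD hwD (by have := (pos_K_h hκ hvκ hvK hτ hh).1; linarith)
    exact hwΛ ⟨by linarith, hwbox⟩

/-! ## §3 The escape-and-climb datum -/

include hκ hvκ hvK hτ hh hCD in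
/-- **The escape-and-climb datum**: if `u ∈ 𝕂`, `w = u + eⱼ ∈ 𝕂` with `H(w) > N`, `Λ ⊆ {H ≤ N}` and `|uᵢ| + n + 1 ≤ M`, then `n + 1` extra open
edges of `[-M, M]³` join `u` to `climb n w` through open exterior steps of `Λ` inside `𝕂`, with probability one (every climb point has height
`≥ H(w) > N`, so no step is a `Λ–Λ` step). [cite: AizenmanChayesChayesFrohlichRusso1983, §4 Lemma 4.2 (a)] -/
theorem escape_climb_datum {N : ℕ} {Λ : Set (Site 3)} (hΛ : ∀ y ∈ Λ, hgt v y ≤ (N : ℝ)) {M : ℕ} (p' : unitInterval) {u : Site 3}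
    (hu : u ∈ D) {j : Fin 3} (hw : u + Pi.single j 1 ∈ D) (hwN : (N : ℝ) < hgt v (u + Pi.single j 1)) :
    ∀ n : ℕ, (∀ i, |u i| + ((n : ℤ) + 1) ≤ (M : ℤ)) → Datum D Λ p' M 1 (n + 1) u (climb v n (u + Pi.single j 1)) := by
  set w := u + Pi.single j 1 with hw_def
  have hbd : ∀ n m : ℕ, (∀ i, |u i| + ((n : ℤ) + 1) ≤ (M : ℤ)) → m ≤ n → ∀ i, |climb v m w i| ≤ (M : ℤ) := by
    intro n m hM hm i
    obtain ⟨a1, a2⟩ := climb_apply_mem v m w i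
    have h1 := hM i
    have hwi : w i = u i + if i = j then 1 else 0 := by rw [hw_def, DiagCone.step_apply]
    have h2 := le_abs_self (u i); have h3 := neg_abs_le (u i)
    rw [abs_le]
    by_cases hij : i = j
    · rw [if_pos hij] at hwi; constructor <;> omega
    · rw [if_neg hij] at hwi; constructor <;> omega
  have hout : ∀ m, climb v m w ∉ Λ := fun m hmem => by
    have h1 := hΛ _ hmem
    have h2 := (hgt_climb hvκ hvK w m).1
    have h3 : (0 : ℝ) ≤ (m : ℝ) * κ := by positivity
    linarith
  intro n
  induction n with
  | zero =>
    intro hM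
    have huM : ∀ i, |u i| ≤ (M : ℤ) := fun i => by have := hM i; push_cast at this; omega
    have h := step_datum (D := D) (Λ := Λ) (M := M) p' ((zdGraph_adj_iff u w).2 ⟨j, Or.inl rfl⟩) hu hw
      (fun h => hout 0 (by simpa using h.2)) huM (hbd 0 0 hM le_rfl)
    simpa [Datum] using h
  | succ n ih =>
    intro hM
    have h₁ := ih (fun i => by have := hM i; push_cast at this ⊢; omega)
    have h₂ := step_datum (D := D) (Λ := Λ) (M := M) p' (climb_adj v n w) (climb_mem hκ hvκ hvK hτ hh hCD hw n)
      (climb_mem hκ hvκ hvK hτ hh hCD hw (n + 1)) (fun h => hout _ h.2) (hbd (n + 1) n hM (by omega)) (hbd (n + 1) (n + 1) hM le_rfl)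
    have h₃ := datum_chain zero_le_one h₁ h₂
    rw [one_mul] at h₃
    exact h₃

end Cone

end WCone

end Summit.CriticalPhenomena.PercolationContinuityZ3.Theorems.Transplant

end
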